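import Summits.ValiantsHypothesis.ValiantsHypothesis.Theses.RealTau
import Literature.Computability.AlgebraicComplexity.RealTauKnownCases

/-!
# `RealTau.RealTauRefined` (stmt-ValiantsHypothesis-18101) — negative side, III: the co-supported (Waring)
# normal form — its rank-3 stratum contains `f g + 1`, and co-supported forms cannot be scale-separated

Refuter (cdisprove gen 2, cycle 1, 2026-08-17), from `Cruxes/RealTauRefined/Disproof.lean` Part III §(n)–(o);
companion of `Negative/FischerPowersLine.lean` (the crux ⇔ the line's open stub `stub_waringCore`, Waring
normal form with CO-SUPPORTED `T`-nomials `h_i`).  The crux is an open conjecture and is NOT refuted here.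
Certified (elementary; no facts, no `def`s):

* `card_roots_fg_sub_one_le_of_quadraticStratum` (+ `roots_fg_add_one`) — the lead's first sub-target Q1
  (crux NOTES cycle 2: zeros of `a² + b² - c²`, equivalently `p q - b²`, for co-supported `T`-nomials = the
  rank-3 quadratic stratum of the normal form at `m = 2`) CONTAINS Koiran's `f g + 1` problem (KPT15 §1,
  Dutta 2021 §1.1: is `Z_ℝ(fg+1) = O(t)`? open since 2011): pad the supports, `E = supp f ∪ supp g ∪ {0}`.
  Any bound `B T` for the stratum gives `Z(fg ∓ 1) ≤ B(2t+1)`; an `O(T)` answer to Q1 settles `fg + 1`.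
* `coSupported_dominance_propagates` — archimedean tropicalisation with COMMON slopes: a form whose `T`
  lines all tie at `u₀` (full Descartes activity) and which dominates a co-supported form at `u₀` dominates it
  at every `u ≥ u₀`.  Hence the disjoint-window lower-bound mechanism of `AdditiveCount.lean`
  (`2K(T-1)+K-1` zeros from supports shifted by monomial prefactors) has NO co-supported analogue: in
  `Σ ε_i h_i^m` at most one `h_i` is fully active where it dominates, window separation yields `≈ 2T + O(K)`
  zeros, and every further zero must be a tie (cancellation) zero between forms of comparable size.
[folklore]
-/

set_option linter.dupNamespace false

namespace Summit.ValiantsHypothesis.ValiantsHypothesis.Theorems.RealTauRefined.Negative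

open Polynomial Finset
open Literature.Computability.AlgebraicComplexity
open Summit.ValiantsHypothesis.ValiantsHypothesis.Theses.RealTau

/-! ### the rank-3 quadratic stratum contains `f g + 1` -/

/-- The lead's first sub-target Q1 (crux NOTES cycle 2: zeros of `a² + b² - c²`, equivalently
`p q - b²`, for `p, q, b` CO-SUPPORTED `T`-nomials — the rank-3 quadratic stratum of the Waring normal
form at `m = 2`) CONTAINS the `f g + 1` problem of Koiran 2011 / KPT15 §1 (is `Z_ℝ(fg+1) = O(t)` for
`t`-sparse `f, g`? open): pad the supports — `f`, `g` and `1` are all supported in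
`E = supp f ∪ supp g ∪ {0}`, `|E| ≤ 2t + 1`.  So any bound `B T` for the stratum gives `Z(fg - 1) ≤ B(2t+1)`;
in particular an `O(T)` answer to Q1 would settle the `f g + 1` problem — Q1's upper-bound direction is
not a warm-up but at least the 2011 open problem (its lower-bound direction is the calibration the
disprover's kit job measures). [folklore] -/
theorem card_roots_fg_sub_one_le_of_quadraticStratum (B : ℕ → ℕ)
    (hQ : ∀ (T : ℕ) (E : Finset ℕ) (p q b : ℝ[X]), E.card ≤ T → p.support ⊆ E → q.support ⊆ E →
      b.support ⊆ E → p * q - b ^ 2 ≠ 0 → (p * q - b ^ 2).roots.toFinset.card ≤ B T)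
    (t : ℕ) (f g : ℝ[X]) (hf : f.support.card ≤ t) (hg : g.support.card ≤ t) (h : f * g - 1 ≠ 0) :
    (f * g - 1).roots.toFinset.card ≤ B (2 * t + 1) := by
  set E : Finset ℕ := f.support ∪ g.support ∪ (1 : ℝ[X]).support with hE
  have h1 : (1 : ℝ[X]).support.card ≤ 1 := by
    simpa using (card_support_C_mul_X_pow_le_one (c := (1 : ℝ)) (n := 0))
  have hcard : E.card ≤ 2 * t + 1 :=
    calc E.card ≤ (f.support ∪ g.support).card + (1 : ℝ[X]).support.card := card_union_le _ _
      _ ≤ (f.support.card + g.support.card) + (1 : ℝ[X]).support.card :=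
          Nat.add_le_add_right (card_union_le _ _) _
      _ ≤ (t + t) + 1 := Nat.add_le_add (Nat.add_le_add hf hg) h1
      _ = 2 * t + 1 := by ring
  have h' : f * g - 1 ^ 2 ≠ 0 := by simpa using h
  have := hQ (2 * t + 1) E f g 1 hcard
    (subset_union_left.trans subset_union_left)
    (subset_union_right.trans subset_union_left) subset_union_right h'
  simpa using this

/-- … and `f g + 1` itself is the case `(-f) g - 1` (same zero set). [folklore] -/
theorem roots_fg_add_one (f g : ℝ[X]) : (f * g + 1).roots = ((-f) * g - 1).roots := by
  rw [show (-f) * g - 1 = -(f * g + 1) by ring, roots_neg]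

/-! ### co-supported forms cannot be scale-separated -/

/-- DOMINANCE PROPAGATES TO THE RIGHT OF A FULL TIE (archimedean tropicalisation of co-supported forms).
Lines `l ↦ a_l + e_l u` (log-magnitudes of the monomials of a `T`-nomial at `x = e^u`) with COMMON slopes
`e_l ≤ e_{iT}`: if all lines of the first form tie at `u₀` (full Descartes activity there — what a
`T`-nomial with `T - 1` zeros near `e^{u₀}` looks like) and strictly dominate every line of a second,
CO-SUPPORTED form at `u₀`, then the top line of the first form strictly dominates the whole second form
at every `u ≥ u₀` (symmetrically to the left with the least slope).  Consequence (Disproof.lean Part III):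
in `Σ_i ε_i h_i^m` with co-supported `h_i` (the lead's `stub_waringCore` normal form) at most ONE `h_i`
can be fully active where it dominates, so the disjoint-windows design behind
`additiveCount_attained_2_2_2` / `waringCount_attained_3_2_2` (supports shifted by monomial prefactors)
has no co-supported analogue: zeros there must come from ties BETWEEN forms. [folklore] -/
theorem coSupported_dominance_propagates {T : ℕ} (e a a' : Fin T → ℝ) (iT : Fin T)
    (hmax : ∀ l, e l ≤ e iT) (u₀ u M : ℝ) (hu : u₀ ≤ u)
    (htie : ∀ l, a l + e l * u₀ = M) (hdom : ∀ l, a' l + e l * u₀ < M) :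
    ∀ l, a' l + e l * u < a iT + e iT * u := by
  intro l
  have h1 : e l * (u - u₀) ≤ e iT * (u - u₀) := mul_le_mul_of_nonneg_right (hmax l) (by linarith)
  have h2 := hdom l
  have h3 := htie iT
  nlinarith

end Summit.ValiantsHypothesis.ValiantsHypothesis.Theorems.RealTauRefined.Negative
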